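import Mathlib
import HarnessLib

/-!
# Poincaré's theorem on linear recurrences — the dominant-root case under an a-priori ratio bracket

Topic `Literature/Analysis/Asymptotics`. Source: S. N. Elaydi, *An Introduction to Difference Equations*,
Springer UTM (1996) [Elaydi1996], Sect. 7.2 "Poincaré's Theorem": **Theorem 7.10 (Poincaré Theorem).**
"Suppose that the roots `λ₁, λ₂, …, λ_k` of [the characteristic equation `λ^k + p₁λ^{k−1} + ⋯ + p_k = 0` of
an equation `x(n+k) + p₁(n)x(n+k−1) + ⋯ + p_k(n)x(n) = 0` of Poincaré type, `p_i(n) → p_i`] have distinct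
moduli. Then for any nontrivial solution `x(n)` … `lim_{n→∞} x(n+1)/x(n) = λ_i` for some `i`"
(H. Poincaré, Amer. J. Math. 7 (1885) [Poincare1885]); and **Lemma 7.14**: "Suppose that
`lim x(n+1)/x(n) = λ ≠ 0`. Then `x(n) = ±λⁿ e^{nν(n)}` for some null sequence `ν(n)`", i.e.
`log|x(n)|/n → log|λ|`.

What is PROVED here (no named facts) is the part of Theorem 7.10 that the arithmetic applications use, in
a directly checkable form: for recurrences of ORDER 2 and ORDER 3 whose solution `u` is known A PRIORI to have
ratios `u(n+1)/u(n) ≥ L > 0` (`n ≥ N`) — the situation produced by the ratio-induction certificates of the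
cell `pub-zeta5` (`Summit.…Zeta5Search.RecurrenceGrowth*`: Apéry's, Zudilin's 2002/2003 recursions) — and
a root `λ ≥ L` of the characteristic equation which is ATTRACTING on `[L, ∞)` (`|b| < L²` in order 2;
`|B|/L² + 2|C|/L³ < 1` in order 3; this forces `λ` to be the unique root `≥ L`, the dominant one in the
applications), the ratios converge: `u(n+1)/u(n) → λ` (`tendsto_ratio_of_recurrence₂`,
`tendsto_ratio_of_recurrence₃`). The proof is the contraction argument behind Poincaré's theorem in this case
(the ratio map `r ↦ a − b/r`, resp. `(x, y) ↦ A + B/y + C/(yx)`, is a perturbed contraction near `λ`;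
an Ostrowski-type stability lemma for perturbed contractions, private below, concludes). Lemma 7.14 is
PROVED as `tendsto_log_abs_div_of_tendsto_ratio` (Cesàro). Consequence for the cell: certified two-sided
ratio BRACKETS become EXACT Poincaré limits `lim log|u_n|/n = log λ` (e.g. `log 2368.317…` for Zudilin's
`ζ(5)` recursion, `log((1+√2)⁴)` for Apéry's), without Poincaré–Perron in full generality.

HONEST FRAMING (cell pub-zeta5): systematic search; no irrationality claim unless certified. Pure real
analysis; nothing here mentions zeta values.
-/

noncomputable section

open Filter Finset
open scoped Topology

namespace Literature.Analysis.Asymptotics.PoincareRecurrence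

/-! ### Perturbed contractions (Ostrowski-type stability) — private tools -/

/-- One-step perturbed contraction: `0 ≤ e`, `e(n+1) ≤ ρ e(n) + ε(n)` (`n ≥ N`), `0 ≤ ρ < 1`, `0 ≤ ε → 0`
imply `e → 0`. [folklore] -/
private theorem tendsto_zero_of_le_mul_add {e ε : ℕ → ℝ} {ρ : ℝ} (N : ℕ) (hρ0 : 0 ≤ ρ) (hρ1 : ρ < 1)
    (he : ∀ n, N ≤ n → 0 ≤ e n)
    (hstep : ∀ n, N ≤ n → e (n + 1) ≤ ρ * e n + ε n) (hε : Tendsto ε atTop (𝓝 0)) :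
    Tendsto e atTop (𝓝 0) := by
  rw [Metric.tendsto_atTop]
  intro δ hδ
  have hgap : 0 < (1 - ρ) * δ / 2 := by
    have : 0 < 1 - ρ := by linarith
    positivity
  obtain ⟨N₁, hN₁⟩ : ∃ N₁, ∀ n, N₁ ≤ n → N ≤ n ∧ ε n < (1 - ρ) * δ / 2 := by
    obtain ⟨M, hM⟩ := (Metric.tendsto_atTop.1 hε) _ hgap
    refine ⟨max M N, fun n hn => ⟨le_trans (le_max_right _ _) hn, ?_⟩⟩
    have h := hM n (le_trans (le_max_left _ _) hn)
    rw [Real.dist_eq, sub_zero] at h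
    exact lt_of_abs_lt h
  -- invariant along `N₁ + m`
  have inv : ∀ m, e (N₁ + m) ≤ ρ ^ m * e N₁ + δ / 2 := by
    intro m
    induction m with
    | zero => simp; linarith
    | succ m ih =>
      obtain ⟨hNm, hεm⟩ := hN₁ (N₁ + m) (Nat.le_add_right _ _)
      have h1 := hstep (N₁ + m) hNm
      rw [show N₁ + (m + 1) = N₁ + m + 1 by ring]
      have h2 : ρ * e (N₁ + m) ≤ ρ * (ρ ^ m * e N₁ + δ / 2) := mul_le_mul_of_nonneg_left ih hρ0
      have h3 : ρ * (ρ ^ m * e N₁ + δ / 2) + (1 - ρ) * δ / 2 = ρ ^ (m + 1) * e N₁ + δ / 2 := by ring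
      linarith
  have hpow : Tendsto (fun m : ℕ => ρ ^ m * e N₁) atTop (𝓝 0) := by
    simpa using (tendsto_pow_atTop_nhds_zero_of_lt_one hρ0 hρ1).mul_const (e N₁)
  obtain ⟨M, hM⟩ := (Metric.tendsto_atTop.1 hpow) (δ / 2) (by linarith)
  refine ⟨N₁ + M, fun n hn => ?_⟩
  obtain ⟨m, rfl⟩ : ∃ m, n = N₁ + m := ⟨n - N₁, by omega⟩
  have hmM : M ≤ m := by omega
  have h1 := hM m hmM
  rw [Real.dist_eq, sub_zero] at h1 ⊢
  have h3 : 0 ≤ e (N₁ + m) := he _ (hN₁ _ (Nat.le_add_right _ _)).1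
  rw [abs_of_nonneg h3]
  have h4 : ρ ^ m * e N₁ < δ / 2 := (abs_lt.1 h1).2
  linarith [inv m]

/-- Two-step perturbed contraction: `0 ≤ e`, `e(n+2) ≤ α e(n+1) + β e(n) + ε(n)` (`n ≥ N`), `α, β ≥ 0`,
`α + β < 1`, `0 ≤ ε → 0` imply `e → 0` (weighted-max reduction to the one-step case). [folklore] -/
private theorem tendsto_zero_of_le_two_step {e ε : ℕ → ℝ} {α β : ℝ} (N : ℕ) (hα : 0 ≤ α) (hβ : 0 ≤ β)
    (hαβ : α + β < 1) (he : ∀ n, N ≤ n → 0 ≤ e n) (hε0 : ∀ n, 0 ≤ ε n)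
    (hstep : ∀ n, N ≤ n → e (n + 2) ≤ α * e (n + 1) + β * e n + ε n) (hε : Tendsto ε atTop (𝓝 0)) :
    Tendsto e atTop (𝓝 0) := by
  -- weight `κ = (1+α+β)/2 ∈ (0,1)` with `α + β/κ < 1`
  set κ : ℝ := (1 + α + β) / 2 with hκ
  have hκ0 : 0 < κ := by rw [hκ]; linarith
  have hκ1 : κ < 1 := by rw [hκ]; linarith
  have hκβ : β < κ * (1 - α) := by
    rw [hκ]; nlinarith
  have hq : α + β / κ < 1 := by
    have : β / κ < 1 - α := by rw [div_lt_iff₀ hκ0]; linarith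
    linarith
  set ρ : ℝ := max (α + β / κ) κ with hρ
  have hρ0 : 0 ≤ ρ := le_trans hκ0.le (le_max_right _ _)
  have hρ1 : ρ < 1 := max_lt hq hκ1
  -- the weighted max `E n = max (e (n+1)) (κ e n)`
  set E : ℕ → ℝ := fun n => max (e (n + 1)) (κ * e n) with hE
  have hE0 : ∀ n, N ≤ n → 0 ≤ E n := fun n hn =>
    le_trans (he (n + 1) (Nat.le_succ_of_le hn)) (le_max_left _ _)
  have hEstep : ∀ n, N ≤ n → E (n + 1) ≤ ρ * E n + ε n := by
    intro n hn
    have hEn := hE0 n hn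
    have h1 : e (n + 1) ≤ E n := le_max_left _ _
    have h2 : κ * e n ≤ E n := le_max_right _ _
    have hen : 0 ≤ e n := he n hn
    have hρα : α + β / κ ≤ ρ := le_max_left _ _
    have hρκ : κ ≤ ρ := le_max_right _ _
    refine max_le ?_ ?_
    · -- `e (n+2) ≤ α e(n+1) + β e n + ε n ≤ (α + β/κ) E n + ε n`
      have h3 := hstep n hn
      have h4 : β * e n = (β / κ) * (κ * e n) := by field_simp
      have h5 : (β / κ) * (κ * e n) ≤ (β / κ) * E n :=
        mul_le_mul_of_nonneg_left h2 (div_nonneg hβ hκ0.le)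
      have h6 : α * e (n + 1) ≤ α * E n := mul_le_mul_of_nonneg_left h1 hα
      have h7 : (α + β / κ) * E n ≤ ρ * E n := mul_le_mul_of_nonneg_right hρα hEn
      rw [show n + 1 + 1 = n + 2 by ring]
      nlinarith
    · have h3 : κ * e (n + 1) ≤ κ * E n := mul_le_mul_of_nonneg_left h1 hκ0.le
      have h4 : κ * E n ≤ ρ * E n := mul_le_mul_of_nonneg_right hρκ hEn
      linarith [hε0 n]
  have hElim : Tendsto E atTop (𝓝 0) := tendsto_zero_of_le_mul_add N hρ0 hρ1 hE0 hEstep hε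
  -- `0 ≤ e (n+1) ≤ E n`
  have hshift : Tendsto (fun n => e (n + 1)) atTop (𝓝 0) := by
    refine squeeze_zero' ?_ ?_ hElim
    · exact (eventually_ge_atTop N).mono fun n hn => he (n + 1) (Nat.le_succ_of_le hn)
    · exact Eventually.of_forall fun n => le_max_left _ _
  exact (tendsto_add_atTop_iff_nat 1).1 hshift

/-! ### Elementary estimates for the ratio maps -/

/-- `|1/x − 1/y| ≤ |x − y|/L²` for `x, y ≥ L > 0`. [folklore] -/
private theorem abs_inv_sub_inv_le {x y L : ℝ} (hL : 0 < L) (hx : L ≤ x) (hy : L ≤ y) :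
    |1 / x - 1 / y| ≤ |x - y| / L ^ 2 := by
  have hx0 : 0 < x := lt_of_lt_of_le hL hx
  have hy0 : 0 < y := lt_of_lt_of_le hL hy
  have e : 1 / x - 1 / y = (y - x) / (x * y) := by field_simp
  rw [e, abs_div, abs_of_pos (mul_pos hx0 hy0), abs_sub_comm]
  have hxy : L ^ 2 ≤ x * y := by nlinarith
  exact div_le_div_of_nonneg_left (abs_nonneg _) (by positivity) hxy

/-- `|1/(y x) − 1/λ²| ≤ (|x − λ| + |y − λ|)/L³` for `x, y, λ ≥ L > 0`. [folklore] -/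
private theorem abs_inv_mul_sub_le {x y lam L : ℝ} (hL : 0 < L) (hx : L ≤ x) (hy : L ≤ y) (hlam : L ≤ lam) :
    |1 / (y * x) - 1 / lam ^ 2| ≤ (|x - lam| + |y - lam|) / L ^ 3 := by
  have hx0 : 0 < x := lt_of_lt_of_le hL hx
  have hy0 : 0 < y := lt_of_lt_of_le hL hy
  have hl0 : 0 < lam := lt_of_lt_of_le hL hlam
  -- split as `(1/(yx) − 1/(yλ)) + (1/(yλ) − 1/λ²)`
  have e : 1 / (y * x) - 1 / lam ^ 2 = (1 / y) * (1 / x - 1 / lam) + (1 / lam) * (1 / y - 1 / lam) := by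
    field_simp
    ring
  rw [e]
  have h1 : |(1 / y) * (1 / x - 1 / lam)| ≤ (1 / L) * (|x - lam| / L ^ 2) := by
    rw [abs_mul, abs_of_pos (by positivity : (0:ℝ) < 1 / y)]
    exact mul_le_mul (one_div_le_one_div_of_le hL hy) (abs_inv_sub_inv_le hL hx hlam)
      (abs_nonneg _) (by positivity)
  have h2 : |(1 / lam) * (1 / y - 1 / lam)| ≤ (1 / L) * (|y - lam| / L ^ 2) := by
    rw [abs_mul, abs_of_pos (by positivity : (0:ℝ) < 1 / lam)]
    exact mul_le_mul (one_div_le_one_div_of_le hL hlam) (abs_inv_sub_inv_le hL hy hlam)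
      (abs_nonneg _) (by positivity)
  have e2 : (1 / L) * (|x - lam| / L ^ 2) + (1 / L) * (|y - lam| / L ^ 2) = (|x - lam| + |y - lam|) / L ^ 3 := by
    have hL0 : L ≠ 0 := hL.ne'
    field_simp
  calc |(1 / y) * (1 / x - 1 / lam) + (1 / lam) * (1 / y - 1 / lam)|
      ≤ |(1 / y) * (1 / x - 1 / lam)| + |(1 / lam) * (1 / y - 1 / lam)| := abs_add_le _ _
    _ ≤ (1 / L) * (|x - lam| / L ^ 2) + (1 / L) * (|y - lam| / L ^ 2) := add_le_add h1 h2
    _ = (|x - lam| + |y - lam|) / L ^ 3 := e2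

/-! ### Poincaré's theorem, order 2 -/

/-- **Poincaré's theorem, order 2, dominant root under an a-priori bracket.** Let
`u(n+2) = s(n) u(n+1) − t(n) u(n)` for `n ≥ N` with `s(n) → a`, `t(n) → b`, and suppose `u(n) ≠ 0` and
`u(n+1)/u(n) ≥ L > 0` for all `n ≥ N`. If `λ ≥ L` is a root of the characteristic equation `λ² = aλ − b`
with `|b| < L²` (so the ratio map `r ↦ a − b/r` contracts on `[L, ∞)` and `λ` is the only root there), then
`u(n+1)/u(n) → λ`. (Special case of Theorem 7.10: the limit exists and is the characteristic root singled
out by the bracket.) [cite: Elaydi1996, Sect. 7.2, Theorem 7.10 (Poincaré's theorem; Poincare1885)] -/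
theorem tendsto_ratio_of_recurrence₂ (u s t : ℕ → ℝ) {a b L lam : ℝ} (N : ℕ)
    (hrec : ∀ n, N ≤ n → u (n + 2) = s n * u (n + 1) - t n * u n)
    (hs : Tendsto s atTop (𝓝 a)) (ht : Tendsto t atTop (𝓝 b))
    (hL : 0 < L) (hu : ∀ n, N ≤ n → u n ≠ 0) (hbr : ∀ n, N ≤ n → L ≤ u (n + 1) / u n)
    (hlam : lam ^ 2 = a * lam - b) (hLlam : L ≤ lam) (hcontr : |b| < L ^ 2) :
    Tendsto (fun n => u (n + 1) / u n) atTop (𝓝 lam) := by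
  set r : ℕ → ℝ := fun n => u (n + 1) / u n with hr
  have hl0 : 0 < lam := lt_of_lt_of_le hL hLlam
  -- the ratio recursion `r (n+1) = s n - t n / r n`
  have hstep : ∀ n, N ≤ n → r (n + 1) = s n - t n / r n := by
    intro n hn
    have hun : u n ≠ 0 := hu n hn
    have hun1 : u (n + 1) ≠ 0 := hu (n + 1) (Nat.le_succ_of_le hn)
    simp only [hr]
    rw [show n + 1 + 1 = n + 2 by ring, hrec n hn]
    field_simp
  -- the fixed point, as `b/λ = a - λ`
  have hfix : b / lam = a - lam := by
    rw [div_eq_iff hl0.ne']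
    linear_combination hlam
  -- error recursion
  set e : ℕ → ℝ := fun n => |r n - lam| with he
  set ε : ℕ → ℝ := fun n => |s n - a| + |t n - b| / L with hε
  have hε0 : ∀ n, 0 ≤ ε n := fun n => by positivity
  have hεlim : Tendsto ε atTop (𝓝 0) := by
    have h1 : Tendsto (fun n => |s n - a|) atTop (𝓝 0) := by
      have := (tendsto_sub_nhds_zero_iff.2 hs).abs; simpa using this
    have h2 : Tendsto (fun n => |t n - b| / L) atTop (𝓝 0) := by
      have := ((tendsto_sub_nhds_zero_iff.2 ht).abs).div_const L; simpa using this
    simpa using h1.add h2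
  have hestep : ∀ n, N ≤ n → e (n + 1) ≤ |b| / L ^ 2 * e n + ε n := by
    intro n hn
    have hrn : L ≤ r n := hbr n hn
    have hrn0 : 0 < r n := lt_of_lt_of_le hL hrn
    simp only [he, hε]
    rw [hstep n hn]
    have e1 : s n - t n / r n - lam
        = (s n - a) + (-((t n - b) / r n) + -(b * (1 / r n - 1 / lam))) := by
      linear_combination -hfix
    rw [e1]
    have h1 : |(t n - b) / r n| ≤ |t n - b| / L := by
      rw [abs_div, abs_of_pos hrn0]
      exact div_le_div_of_nonneg_left (abs_nonneg _) hL hrn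
    have h2 : |b * (1 / r n - 1 / lam)| ≤ |b| * (|r n - lam| / L ^ 2) := by
      rw [abs_mul]; exact mul_le_mul_of_nonneg_left (abs_inv_sub_inv_le hL hrn hLlam) (abs_nonneg _)
    calc |(s n - a) + (-((t n - b) / r n) + -(b * (1 / r n - 1 / lam)))|
        ≤ |s n - a| + |-((t n - b) / r n) + -(b * (1 / r n - 1 / lam))| := abs_add_le _ _
      _ ≤ |s n - a| + (|-((t n - b) / r n)| + |-(b * (1 / r n - 1 / lam))|) := by
          gcongr; exact abs_add_le _ _
      _ = |s n - a| + (|(t n - b) / r n| + |b * (1 / r n - 1 / lam)|) := by rw [abs_neg, abs_neg]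
      _ ≤ |s n - a| + (|t n - b| / L + |b| * (|r n - lam| / L ^ 2)) := by gcongr
      _ = |b| / L ^ 2 * |r n - lam| + (|s n - a| + |t n - b| / L) := by ring
  have hρ1 : |b| / L ^ 2 < 1 := by rwa [div_lt_one (by positivity)]
  have helim : Tendsto e atTop (𝓝 0) :=
    tendsto_zero_of_le_mul_add N (by positivity) hρ1 (fun n _ => abs_nonneg _) hestep hεlim
  -- conclude
  have : Tendsto (fun n => r n - lam) atTop (𝓝 0) := by
    rw [tendsto_zero_iff_abs_tendsto_zero]; exact helim
  simpa using tendsto_sub_nhds_zero_iff.1 this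

/-! ### Poincaré's theorem, order 3 -/

/-- **Poincaré's theorem, order 3, dominant root under an a-priori bracket.** Let
`u(n+3) = a(n) u(n+2) + b(n) u(n+1) + c(n) u(n)` for `n ≥ N` with `a(n) → A`, `b(n) → B`, `c(n) → C`, and
suppose `u(n) ≠ 0` and `u(n+1)/u(n) ≥ L > 0` for all `n ≥ N`. If `λ ≥ L` satisfies `λ³ = Aλ² + Bλ + C` and
`|B|/L² + 2|C|/L³ < 1` (the two-step ratio map `(x, y) ↦ A + B/y + C/(yx)` contracts on `[L, ∞)²`), then
`u(n+1)/u(n) → λ`. [cite: Elaydi1996, Sect. 7.2, Theorem 7.10 (Poincaré's theorem; Poincare1885)] -/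
theorem tendsto_ratio_of_recurrence₃ (u a b c : ℕ → ℝ) {A B C L lam : ℝ} (N : ℕ)
    (hrec : ∀ n, N ≤ n → u (n + 3) = a n * u (n + 2) + b n * u (n + 1) + c n * u n)
    (ha : Tendsto a atTop (𝓝 A)) (hb : Tendsto b atTop (𝓝 B)) (hc : Tendsto c atTop (𝓝 C))
    (hL : 0 < L) (hu : ∀ n, N ≤ n → u n ≠ 0) (hbr : ∀ n, N ≤ n → L ≤ u (n + 1) / u n)
    (hlam : lam ^ 3 = A * lam ^ 2 + B * lam + C) (hLlam : L ≤ lam)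
    (hcontr : |B| / L ^ 2 + 2 * |C| / L ^ 3 < 1) :
    Tendsto (fun n => u (n + 1) / u n) atTop (𝓝 lam) := by
  set r : ℕ → ℝ := fun n => u (n + 1) / u n with hr
  have hl0 : 0 < lam := lt_of_lt_of_le hL hLlam
  -- the two-step ratio recursion `r (n+2) = a n + b n / r (n+1) + c n / (r (n+1) * r n)`
  have hstep : ∀ n, N ≤ n → r (n + 2) = a n + b n / r (n + 1) + c n / (r (n + 1) * r n) := by
    intro n hn
    have hun : u n ≠ 0 := hu n hn
    have hun1 : u (n + 1) ≠ 0 := hu (n + 1) (by omega)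
    have hun2 : u (n + 2) ≠ 0 := hu (n + 2) (by omega)
    simp only [hr]
    rw [show n + 2 + 1 = n + 3 by ring, hrec n hn, show n + 1 + 1 = n + 2 by ring]
    field_simp
  -- the fixed point, as `B/λ + C/λ² = λ - A`
  have hfix : B / lam + C / lam ^ 2 = lam - A := by
    have e : B / lam + C / lam ^ 2 = (B * lam + C) / lam ^ 2 := by
      field_simp
    rw [e, div_eq_iff (by positivity)]
    linear_combination -hlam
  set e : ℕ → ℝ := fun n => |r n - lam| with he
  set ε : ℕ → ℝ := fun n => |a n - A| + |b n - B| / L + |c n - C| / L ^ 2 with hε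
  have hε0 : ∀ n, 0 ≤ ε n := fun n => by positivity
  have hεlim : Tendsto ε atTop (𝓝 0) := by
    have h1 : Tendsto (fun n => |a n - A|) atTop (𝓝 0) := by
      have := (tendsto_sub_nhds_zero_iff.2 ha).abs; simpa using this
    have h2 : Tendsto (fun n => |b n - B| / L) atTop (𝓝 0) := by
      have := ((tendsto_sub_nhds_zero_iff.2 hb).abs).div_const L; simpa using this
    have h3 : Tendsto (fun n => |c n - C| / L ^ 2) atTop (𝓝 0) := by
      have := ((tendsto_sub_nhds_zero_iff.2 hc).abs).div_const (L ^ 2); simpa using this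
    simpa using (h1.add h2).add h3
  have hestep : ∀ n, N ≤ n →
      e (n + 2) ≤ (|B| / L ^ 2 + |C| / L ^ 3) * e (n + 1) + |C| / L ^ 3 * e n + ε n := by
    intro n hn
    have hx : L ≤ r n := hbr n hn
    have hy : L ≤ r (n + 1) := hbr (n + 1) (by omega)
    have hx0 : 0 < r n := lt_of_lt_of_le hL hx
    have hy0 : 0 < r (n + 1) := lt_of_lt_of_le hL hy
    simp only [he, hε]
    rw [hstep n hn]
    have e1 : a n + b n / r (n + 1) + c n / (r (n + 1) * r n) - lam
        = (a n - A) + ((b n - B) / r (n + 1) + B * (1 / r (n + 1) - 1 / lam))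
          + ((c n - C) / (r (n + 1) * r n) + C * (1 / (r (n + 1) * r n) - 1 / lam ^ 2)) := by
      linear_combination hfix
    rw [e1]
    have h1 : |(b n - B) / r (n + 1)| ≤ |b n - B| / L := by
      rw [abs_div, abs_of_pos hy0]
      exact div_le_div_of_nonneg_left (abs_nonneg _) hL hy
    have h2 : |B * (1 / r (n + 1) - 1 / lam)| ≤ |B| * (|r (n + 1) - lam| / L ^ 2) := by
      rw [abs_mul]; exact mul_le_mul_of_nonneg_left (abs_inv_sub_inv_le hL hy hLlam) (abs_nonneg _)
    have h3 : |(c n - C) / (r (n + 1) * r n)| ≤ |c n - C| / L ^ 2 := by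
      rw [abs_div, abs_of_pos (mul_pos hy0 hx0)]
      exact div_le_div_of_nonneg_left (abs_nonneg _) (by positivity) (by nlinarith)
    have h4 : |C * (1 / (r (n + 1) * r n) - 1 / lam ^ 2)| ≤ |C| * ((|r n - lam| + |r (n + 1) - lam|) / L ^ 3) := by
      rw [abs_mul]; exact mul_le_mul_of_nonneg_left (abs_inv_mul_sub_le hL hx hy hLlam) (abs_nonneg _)
    calc |a n - A + ((b n - B) / r (n + 1) + B * (1 / r (n + 1) - 1 / lam))
          + ((c n - C) / (r (n + 1) * r n) + C * (1 / (r (n + 1) * r n) - 1 / lam ^ 2))|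
        ≤ |a n - A + ((b n - B) / r (n + 1) + B * (1 / r (n + 1) - 1 / lam))|
          + |(c n - C) / (r (n + 1) * r n) + C * (1 / (r (n + 1) * r n) - 1 / lam ^ 2)| := abs_add_le _ _
      _ ≤ (|a n - A| + (|(b n - B) / r (n + 1)| + |B * (1 / r (n + 1) - 1 / lam)|))
          + (|(c n - C) / (r (n + 1) * r n)| + |C * (1 / (r (n + 1) * r n) - 1 / lam ^ 2)|) := by
          gcongr
          · exact (abs_add_le _ _).trans (by gcongr; exact abs_add_le _ _)
          · exact abs_add_le _ _
      _ ≤ (|a n - A| + (|b n - B| / L + |B| * (|r (n + 1) - lam| / L ^ 2)))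
          + (|c n - C| / L ^ 2 + |C| * ((|r n - lam| + |r (n + 1) - lam|) / L ^ 3)) := by gcongr
      _ = (|B| / L ^ 2 + |C| / L ^ 3) * |r (n + 1) - lam| + |C| / L ^ 3 * |r n - lam|
          + (|a n - A| + |b n - B| / L + |c n - C| / L ^ 2) := by ring
  have hαβ : (|B| / L ^ 2 + |C| / L ^ 3) + |C| / L ^ 3 < 1 := by
    have : (|B| / L ^ 2 + |C| / L ^ 3) + |C| / L ^ 3 = |B| / L ^ 2 + 2 * |C| / L ^ 3 := by ring
    rw [this]; exact hcontr
  have helim : Tendsto e atTop (𝓝 0) :=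
    tendsto_zero_of_le_two_step N (by positivity) (by positivity) hαβ (fun n _ => abs_nonneg _) hε0
      hestep hεlim
  have : Tendsto (fun n => r n - lam) atTop (𝓝 0) := by
    rw [tendsto_zero_iff_abs_tendsto_zero]; exact helim
  simpa using tendsto_sub_nhds_zero_iff.1 this

/-! ### From ratio limits to exponential rates (Lemma 7.14) -/

/-- **Elaydi's Lemma 7.14** (rate from ratio): if `u(n) ≠ 0` for `n ≥ N` and `u(n+1)/u(n) → λ ≠ 0`, then
`log|u(n)|/n → log|λ|` ("`x(n) = ±λⁿe^{nν(n)}` for some null sequence `ν`"). Proof: Cesàro mean of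
`log|u(n+1)/u(n)|`. [cite: Elaydi1996, Sect. 7.2, Lemma 7.14] -/
theorem tendsto_log_abs_div_of_tendsto_ratio (u : ℕ → ℝ) {lam : ℝ} (N : ℕ)
    (hu : ∀ n, N ≤ n → u n ≠ 0) (hlam : lam ≠ 0)
    (hr : Tendsto (fun n => u (n + 1) / u n) atTop (𝓝 lam)) :
    Tendsto (fun n => Real.log |u n| / n) atTop (𝓝 (Real.log |lam|)) := by
  -- `v m = log |u (N+m+1) / u (N+m)| → log |λ|`
  set v : ℕ → ℝ := fun m => Real.log |u (N + m + 1) / u (N + m)| with hv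
  have hvlim : Tendsto v atTop (𝓝 (Real.log |lam|)) := by
    have h1 : Tendsto (fun m => u (N + m + 1) / u (N + m)) atTop (𝓝 lam) := by
      have := (tendsto_add_atTop_iff_nat N).2 hr
      refine this.congr fun m => ?_
      rw [add_comm m N]
    exact (h1.abs).log (abs_ne_zero.2 hlam)
  -- telescoping: `log |u (N+m)| = log |u N| + ∑_{i<m} v i`
  have htel : ∀ m, Real.log |u (N + m)| = Real.log |u N| + ∑ i ∈ range m, v i := by
    intro m
    induction m with
    | zero => simp
    | succ m ih =>
      rw [sum_range_succ, ← add_assoc (Real.log |u N|), ← ih]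
      have h0 : u (N + m) ≠ 0 := hu _ (Nat.le_add_right _ _)
      have h1 : u (N + m + 1) ≠ 0 := hu _ (by omega)
      simp only [hv]
      rw [abs_div, Real.log_div (abs_ne_zero.2 h1) (abs_ne_zero.2 h0), show N + (m + 1) = N + m + 1 by ring]
      ring
  -- Cesàro
  have hces : Tendsto (fun m : ℕ => (m⁻¹ : ℝ) * ∑ i ∈ range m, v i) atTop (𝓝 (Real.log |lam|)) :=
    hvlim.cesaro
  -- `log|u (N+m)|/(N+m) = (m/(N+m)) * cesaro + log|u N|/(N+m)`
  have hratio : Tendsto (fun m : ℕ => (m : ℝ) / ((N : ℝ) + m)) atTop (𝓝 1) := by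
    have h : Tendsto (fun m : ℕ => ((N : ℝ) + m) / (m : ℝ)) atTop (𝓝 1) := by
      have h1 : Tendsto (fun m : ℕ => (N : ℝ) / (m : ℝ)) atTop (𝓝 0) :=
        tendsto_const_div_atTop_nhds_zero_nat (N : ℝ)
      have h2 : Tendsto (fun m : ℕ => (N : ℝ) / (m : ℝ) + 1) atTop (𝓝 (0 + 1)) := h1.add_const 1
      rw [zero_add] at h2
      refine h2.congr' ?_
      filter_upwards [eventually_gt_atTop 0] with m hm
      have : (m : ℝ) ≠ 0 := by exact_mod_cast hm.ne'
      field_simp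
    have := h.inv₀ one_ne_zero
    rw [inv_one] at this
    refine this.congr' ?_
    filter_upwards [eventually_gt_atTop 0] with m hm
    rw [inv_div]
  have hconst : Tendsto (fun m : ℕ => Real.log |u N| / ((N : ℝ) + m)) atTop (𝓝 0) := by
    have h1 : Tendsto (fun m : ℕ => ((N : ℝ) + m)) atTop atTop :=
      tendsto_atTop_add_const_left atTop (N : ℝ) tendsto_natCast_atTop_atTop
    have h2 := (h1.inv_tendsto_atTop).const_mul (Real.log |u N|)
    rw [mul_zero] at h2
    exact h2.congr fun m => by simp [div_eq_mul_inv]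
  have hmain : Tendsto (fun m : ℕ => Real.log |u (N + m)| / ((N : ℝ) + m)) atTop (𝓝 (Real.log |lam|)) := by
    have h := (hratio.mul hces).add hconst
    rw [one_mul, add_zero] at h
    refine h.congr' ?_
    filter_upwards [eventually_gt_atTop 0] with m hm
    rw [htel m]
    have hm0 : (m : ℝ) ≠ 0 := by exact_mod_cast hm.ne'
    have hNm : (N : ℝ) + m ≠ 0 := by positivity
    field_simp
    ring
  -- back to `n = N + m`
  rw [← tendsto_add_atTop_iff_nat N]
  refine hmain.congr fun m => ?_
  rw [add_comm m N, Nat.cast_add]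

end Literature.Analysis.Asymptotics.PoincareRecurrence
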